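import Literature.NumberTheory.EllipticCurves.IwasawaSelmer
import Literature.NumberTheory.EllipticCurves.IwasawaAlgebraInvolution
import Summits.BirchSwinnertonDyer.Rank1Residual.X1.LambdaParity
import Summits.BirchSwinnertonDyer.Rank1Residual.X1.LambdaSqueezeAlgebra
import HarnessLib

/-!
# BirchSwinnertonDyer / ClassRecordThree — support lemma for the crux `SchneiderAtThree`
# (item stmt-BirchSwinnertonDyer-19106), D-0145 line «second-jet door» (bsd-idea-4, gen 4):
# `ι`-STABILITY OF THE CHARACTERISTIC IDEAL FORCES `ord_{T=0} f_E ≡ λ(X) (mod 2)`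

Pure `Λ`-algebra (`Λ = ℤ_p⟦T⟧`, `p ≠ 2`, `ι = IwasawaAlgebra.invol p : T ↦ (1+T)⁻¹ − 1`), two lemmas:

* `exists_isUnit_invol_eq_mul_of_map_invol_eq` — if a principal ideal `I = (f)` of `Λ` is fixed by `ι`
  (`Ideal.map ι I = I`, the shape of Greenberg, LNM 1716, Thm. 1.14: "the characteristic ideal of
  `X_E(F_∞)` is fixed by the involution `ι`"), then `ι f = u · f` for a unit `u` (equal principal ideals
  in a domain have associated generators);
* `order_mod_two_eq_lambdaInvariant_of_invol_eq_mul` — if `char_Λ(M) = (f)`, `f ≠ 0`, `M` finitely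
  generated torsion, and `ι f = u · f` with `u ∈ Λˣ`, then `ord_{T=0} f ≡ λ(M) (mod 2)`: comparing lowest
  terms in `Λ` gives `u(0) = (−1)^{ord_T f}` (`X1.LambdaParity.eq_neg_one_pow_order_of_subst_eq_C_mul`),
  reducing `f / p^{μ}` modulo `p` gives `u(0) = (−1)^{λ(f)}` (`X1.LambdaParity.sign_eq_neg_one_pow_lam`),
  and `λ(f) = λ(M)` (`X1.ParitySqueeze.lam_generator_eq_lambdaInvariant`); `−1 ≢ 1 (mod p)`.

Role in the line (skeleton `Cruxes/SchneiderAtThree` candidate `Lines/second-jet.lean`, evidence #32 on the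
item): with Greenberg Prop. 3.10 (`corank Sel ≡ λ`), GZK (`rank = 1`, `Ш` finite) and Kato–Wuthrich
divisibility (`ord_T f_E ≤ ord_T L_3`) it turns the second-jet bound `ord_T L_3(E,T) ≤ 2` into
`ord_T f_E = 1 = rank`, whence Schneider non-degeneracy by Stein–Wuthrich 2013 Thm. 6.1 (2). HONESTY: a
support lemma only; the crux `SchneiderAtThree`, the class row and BSD are NOT proved; the line's heart
(`ord_T L_3 ≤ 2` on the locus) is open. Barrier placement: inside `PAdicFunctionalEquationParity`'s class and
consistent with it — the involution yields parity ONLY (cf. `padicCentralOrders_eq` there).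
-/

set_option linter.dupNamespace false
set_option autoImplicit false

namespace Summit.BirchSwinnertonDyer.BirchSwinnertonDyer.Theorems

open Literature.NumberTheory.EllipticCurves Summit.BirchSwinnertonDyer.Rank1Residual

/-- **Generator form of `ι`-stability.** In `Λ = ℤ_p⟦T⟧` (a domain), if the principal ideal `(f)` is fixed
by the involution `ι` then `ι f = u · f` for some unit `u`.
[cite: GreenbergLNM1716, Thm. 1.14 (p. 68 of LNM 1716 in the Cetraro volume: "fixed by the involution ι")]
[cite: Washington1997, §13.2] -/
theorem exists_isUnit_invol_eq_mul_of_map_invol_eq {p : ℕ} [Fact p.Prime]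
    {I : Ideal (IwasawaAlgebra p)} {f : IwasawaAlgebra p} (hI : I = Ideal.span {f})
    (hmap : Ideal.map (IwasawaAlgebra.invol p) I = I) :
    ∃ u : IwasawaAlgebra p, IsUnit u ∧ IwasawaAlgebra.invol p f = u * f := by
  subst hI
  rw [Ideal.map_span, Set.image_singleton] at hmap
  obtain ⟨u, hu⟩ := Ideal.span_singleton_eq_span_singleton.mp hmap
  refine ⟨((u⁻¹ : (IwasawaAlgebra p)ˣ) : IwasawaAlgebra p), Units.isUnit _, ?_⟩
  calc IwasawaAlgebra.invol p f
      = IwasawaAlgebra.invol p f * (u : IwasawaAlgebra p) *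
          ((u⁻¹ : (IwasawaAlgebra p)ˣ) : IwasawaAlgebra p) := by
        rw [mul_assoc, Units.mul_inv, mul_one]
    _ = f * ((u⁻¹ : (IwasawaAlgebra p)ˣ) : IwasawaAlgebra p) := by rw [hu]
    _ = ((u⁻¹ : (IwasawaAlgebra p)ˣ) : IwasawaAlgebra p) * f := mul_comm _ _

/-- **`ι`-stability forces the parity of the order of vanishing.** For `p ≠ 2`, a finitely generated
torsion `Λ`-module `M` with `char_Λ(M) = (f)`, `f ≠ 0`, and `ι f = u · f` with `u` a unit:
`ord_{T=0} f ≡ λ(M) (mod 2)` (as natural numbers; `ord_T f < ∞`).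
[cite: GreenbergLNM1716, Thm. 1.14 and Prop. 3.10] [cite: Washington1997, §7.1, §13.2] -/
theorem order_mod_two_eq_lambdaInvariant_of_invol_eq_mul {p : ℕ} [Fact p.Prime] (hp : p ≠ 2)
    (M : Type*) [AddCommGroup M] [Module (IwasawaAlgebra p) M] [Module.Finite (IwasawaAlgebra p) M]
    (hM : Module.IsTorsion (IwasawaAlgebra p) M) {f u : IwasawaAlgebra p} (hf0 : f ≠ 0)
    (hchar : Literature.NumberTheory.EllipticCurves.Module.charIdeal (IwasawaAlgebra p) M = Ideal.span {f})
    (hu : IsUnit u) (hinv : IwasawaAlgebra.invol p f = u * f) :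
    ∃ n : ℕ, f.order = n ∧ n % 2 = lambdaInvariant p M % 2 := by
  classical
  have hoT : f.order ≠ ⊤ := fun h ↦ hf0 (PowerSeries.order_eq_top.mp h)
  obtain ⟨n, hn⟩ := ENat.ne_top_iff_exists.mp hoT
  refine ⟨n, hn.symm, ?_⟩
  have hι : (1 + PowerSeries.X : IwasawaAlgebra p) * (IwasawaAlgebra.invSubOne p + 1) = 1 := by
    rw [add_comm (IwasawaAlgebra.invSubOne p) 1]
    exact IwasawaAlgebra.one_add_X_mul_one_add_invSubOne p
  obtain ⟨s, hs⟩ := PowerSeries.isUnit_constantCoeff u hu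
  set B : IwasawaAlgebra p := PowerSeries.C ((s⁻¹ : ℤ_[p]ˣ) : ℤ_[p]) * u with hBdef
  have hB : PowerSeries.constantCoeff B = 1 := by
    rw [hBdef, map_mul, PowerSeries.constantCoeff_C, ← hs, Units.inv_mul]
  have hform : PowerSeries.subst (IwasawaAlgebra.invSubOne p) f =
      PowerSeries.C (s : ℤ_[p]) * B * f := by
    rw [← IwasawaAlgebra.invol_apply p f, hinv, hBdef, ← mul_assoc, ← map_mul, Units.mul_inv,
      map_one, one_mul]
  have h1 := X1.LambdaParity.eq_neg_one_pow_order_of_subst_eq_C_mul hι hB hf0 hform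
  rw [← hn, ENat.toNat_coe] at h1
  have hσpm : (s : ℤ_[p]) = 1 ∨ (s : ℤ_[p]) = -1 := by
    rw [h1]; exact neg_one_pow_eq_or ℤ_[p] n
  have h2 := X1.LambdaParity.sign_eq_neg_one_pow_lam hp hι hσpm hB hf0 hform
  have hlam : X1.MuLambda.lam f = lambdaInvariant p M :=
    X1.ParitySqueeze.lam_generator_eq_lambdaInvariant M hM hf0 hchar
  have hne : (-1 : ℤ_[p]) ≠ 1 := fun h ↦ X1.LambdaParity.residue_neg_one_ne_one hp (by rw [h])
  have key : ((-1 : ℤ_[p]) ^ n) = (-1) ^ (lambdaInvariant p M) := by rw [← h1, h2, hlam]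
  have hiff : Even n ↔ Even (lambdaInvariant p M) := by
    rw [← neg_one_pow_eq_one_iff_even hne, key, neg_one_pow_eq_one_iff_even hne]
  rcases Nat.even_or_odd n with hen | hon
  · rw [Nat.even_iff.mp hen, Nat.even_iff.mp (hiff.mp hen)]
  · have hol : Odd (lambdaInvariant p M) :=
      Nat.not_even_iff_odd.mp fun h ↦ (Nat.not_even_iff_odd.mpr hon) (hiff.mpr h)
    rw [Nat.odd_iff.mp hon, Nat.odd_iff.mp hol]

/-- **Combined form** (what the line's kernel consumes): `char_Λ(M) = (f)` fixed by `ι` as an ideal,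
`f ≠ 0`, `p ≠ 2` ⟹ `ord_{T=0} f ≡ λ(M) (mod 2)`. [cite: GreenbergLNM1716, Thm. 1.14, Prop. 3.10] -/
theorem order_mod_two_eq_lambdaInvariant_of_map_invol_eq {p : ℕ} [Fact p.Prime] (hp : p ≠ 2)
    (M : Type*) [AddCommGroup M] [Module (IwasawaAlgebra p) M] [Module.Finite (IwasawaAlgebra p) M]
    (hM : Module.IsTorsion (IwasawaAlgebra p) M) {f : IwasawaAlgebra p} (hf0 : f ≠ 0)
    (hchar : Literature.NumberTheory.EllipticCurves.Module.charIdeal (IwasawaAlgebra p) M = Ideal.span {f})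
    (hmap : Ideal.map (IwasawaAlgebra.invol p)
      (Literature.NumberTheory.EllipticCurves.Module.charIdeal (IwasawaAlgebra p) M) =
      Literature.NumberTheory.EllipticCurves.Module.charIdeal (IwasawaAlgebra p) M) :
    ∃ n : ℕ, f.order = n ∧ n % 2 = lambdaInvariant p M % 2 := by
  obtain ⟨u, hu, hinv⟩ := exists_isUnit_invol_eq_mul_of_map_invol_eq hchar hmap
  exact order_mod_two_eq_lambdaInvariant_of_invol_eq_mul hp M hM hf0 hchar hu hinv

end Summit.BirchSwinnertonDyer.BirchSwinnertonDyer.Theorems
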